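import Summits.Ventures.PercRepro.OrbitK

/-!
# PercRepro — `Φ(11, 7) = 77/18`, `Φ(12, 7) = 20/3`, `Φ(13, 7) = 299/30` (p7 g23; the constants of the row devices 11 … 13 at level `7`)

The lossy-ladder constants `κ_k = (Φ(P, 7) − 2(2^k − 1))/2^k` of the rows: `P = 11`: `κ₁ = 41/36 ≤ Φ(10,7)`, `κ₂ < 0`;
`P = 12`: `κ₁ = 7/3 ≤ Φ(11,7)`, `κ₂ = 1/6 ≤ Φ(10,7)`, `κ₃ < 0`; `P = 13`: `κ₁ = 239/60 ≤ Φ(12,7)`, `κ₂ = 119/120 ≤ Φ(11,7)`, `κ₃ < 0`.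
Nothing else is claimed.

* `phiK_eleven_seven`, `phiK_twelve_seven`, `phiK_thirteen_seven`.
Axioms: standard.
-/

namespace PercRepro

namespace S4Ups

/-- `Φ(11, 7) = 77/18` exactly. -/
theorem phiK_eleven_seven : phiK 11 7 = 77 / 18 := by
  unfold phiK
  rw [show Finset.Ioo 7 11 = Finset.Icc 8 10 by decide]
  norm_num [Finset.sum_Icc_succ_top, Nat.choose]

/-- `Φ(12, 7) = 20/3` exactly. -/
theorem phiK_twelve_seven : phiK 12 7 = 20 / 3 := by
  unfold phiK
  rw [show Finset.Ioo 7 12 = Finset.Icc 8 11 by decide]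
  norm_num [Finset.sum_Icc_succ_top, Nat.choose]

/-- `Φ(13, 7) = 299/30` exactly. -/
theorem phiK_thirteen_seven : phiK 13 7 = 299 / 30 := by
  unfold phiK
  rw [show Finset.Ioo 7 13 = Finset.Icc 8 12 by decide]
  norm_num [Finset.sum_Icc_succ_top, Nat.choose]

end S4Ups

end PercRepro
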